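import Summits.AtomisticToContinuum.FouriersLaw.Theorems.BondHeatUncertaintyExtensiveSnapshotIrreversibilityEnergyWindowFlowJacobianMoment
import HarnessLib

/-!
# Bond heat uncertainty — energy window: the exponential energy budget of a driven path

Cell `decomp-a2c`, lens-1 «grading / quantitative ladder», generation 84, crux
`stmt-AtomisticToContinuum-9121` (`ExtensiveSnapshotIrreversibility`, K_fix half, leaf S3), part I-A
(imports TREE modules only).  Critic rows 1182 (4) (g3) / 1188: the binder of record beneath
(MD₂)/(SW⁰₂) is (MC∞) `SkeletonGramLimitInverseMoments`; part I-B (`…EnergyBudgetFloor`) splits its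
anharmonic discharge as (MC∞) ⟸ (EBF) `EnergyBudgetGramFloor` (measure-free) ∧ (EBM)
`EnergyBudgetMoment` (measure half).  This file supplies the CURRENCY and PROVES (EBM):

* `energyBudget θ z wp = Θ_θ(z, wp) = ∫₀¹ exp(θ H(Φ_u(z, B(wp)))) du ≥ 1` (§1) — the exponential
  energy budget of the driven path on the unit time window.  For every `θ > 0` it dominates the
  Grönwall budget `exp ∫₀¹ (A₀ + A₁ √H)` of the linearised flow and of its costates (Young +
  Jensen, parts (FJ)/(JM)) and every polynomial time integral `∫₀¹ (1 + H)^k` of the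
  coefficients `Hess Φ(q_u)` of the costate equation — everything a DETERMINISTIC lower bound on
  the Gram/Malliavin matrix along one path may depend on.
* power means increase (§2, Jensen for `x ↦ x^r` from Bernoulli): `(∫₀¹ g)^r ≤ ∫₀¹ g^r`, whence
  `Θ_θ^r ≤ Θ_{rθ}` — so only a LINEAR moment of the budget is ever needed;
* **(EBM) PROVED** (§3): `E Θ_θ(z, ·) ≤ e^{θγ(T_L+T_R)} e^{θH(z)}` for `0 < θ < 1/max(T_L, T_R)`
  — Tonelli + the fixed-time exponential moment CEHR (3.4) (tree
  `pinnedChain_lintegral_exp_hamiltonian_solMap_le`), the (JM) pattern of part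
  `…EnergyWindowFlowJacobianMoment`.
No instance / notation / option; no proof holes.  References: the tree files above;
[cite: CuneoEckmannHairerReyBellet2018, §3 eq. (3.4)]. [folklore]
-/

noncomputable section

namespace Summit.AtomisticToContinuum.FouriersLaw.Theorems.ExtensiveSnapshotIrreversibility.EnergyWindow

open MeasureTheory Filter Topology Set
open scoped ENNReal NNReal
open Literature.MathematicalPhysics.KineticTheory.HeatConduction Literature.Probability.Process

/-! ## 1. The energy budget of a driven path -/

section Budget

variable (ω₂ lam β γ : ℝ) (N : ℕ) (T_L T_R : ℝ)

/-- The energy `H(Φ_u(z, B(wp)))` along the driven trajectory started at `z`. [folklore] -/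
def pathEnergy (z : PhaseSpace N) (wp : WienerPair) (u : ℝ) : ℝ :=
  (pinnedChain ω₂ lam β γ).hamiltonian N
    ((pinnedChain ω₂ lam β γ).solMap N T_L T_R u z (pairPath wp))

/-- **The exponential energy budget** `Θ_θ(z, wp) = ∫₀¹ exp(θ H(Φ_u(z, B(wp)))) du` of the driven
path on the unit time window (`≥ 1`; all the path-dependence a deterministic observability floor is
allowed). [NEW · currency of (EBF)/(EBM)] -/
def energyBudget (θ : ℝ) (z : PhaseSpace N) (wp : WienerPair) : ℝ :=
  ∫ u in (0 : ℝ)..1, Real.exp (θ * pathEnergy ω₂ lam β γ N T_L T_R z wp u)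

variable {ω₂ lam β γ N T_L T_R}

/-- The path energy is non-negative. [folklore] -/
theorem pathEnergy_nonneg (hω : 0 ≤ ω₂) (hl : 0 ≤ lam) (hβ : 0 ≤ β) (z : PhaseSpace N)
    (wp : WienerPair) (u : ℝ) : 0 ≤ pathEnergy ω₂ lam β γ N T_L T_R z wp u :=
  pinnedChain_hamiltonian_nonneg hω hl hβ γ N _

/-- The path energy is continuous in time. [folklore] -/
theorem continuous_pathEnergy (hω : 0 < ω₂) (hl : 0 ≤ lam) (hβ : 0 ≤ β) (hγ : 0 ≤ γ)
    (z : PhaseSpace N) (wp : WienerPair) :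
    Continuous (pathEnergy ω₂ lam β γ N T_L T_R z wp) :=
  (pinnedChain_continuous_hamiltonian ω₂ lam β γ N).comp
    (pinnedChain_continuous_solMap hω hl hβ hγ N T_L T_R z (pairPath wp))

/-- The path energy at a fixed time is measurable in the noise. [folklore] -/
theorem measurable_pathEnergy (hω : 0 < ω₂) (hl : 0 ≤ lam) (hβ : 0 ≤ β) (hγ : 0 ≤ γ)
    (z : PhaseSpace N) (u : ℝ) :
    Measurable fun wp => pathEnergy ω₂ lam β γ N T_L T_R z wp u :=
  (pinnedChain_continuous_hamiltonian ω₂ lam β γ N).measurable.comp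
    (pinnedChain_measurable_solMap_pairPath_right hω hl hβ hγ N T_L T_R u z)

/-- The integrand of the budget is continuous in time. [folklore] -/
theorem continuous_exp_mul_pathEnergy (hω : 0 < ω₂) (hl : 0 ≤ lam) (hβ : 0 ≤ β) (hγ : 0 ≤ γ)
    (θ : ℝ) (z : PhaseSpace N) (wp : WienerPair) :
    Continuous fun u => Real.exp (θ * pathEnergy ω₂ lam β γ N T_L T_R z wp u) :=
  (continuous_const.mul (continuous_pathEnergy hω hl hβ hγ z wp)).rexp

/-- `Θ_θ ≥ 1` for `θ ≥ 0` (the integrand is `≥ 1` on a window of length one). [folklore] -/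
theorem one_le_energyBudget (hω : 0 < ω₂) (hl : 0 ≤ lam) (hβ : 0 ≤ β) (hγ : 0 ≤ γ) {θ : ℝ}
    (hθ : 0 ≤ θ) (z : PhaseSpace N) (wp : WienerPair) :
    1 ≤ energyBudget ω₂ lam β γ N T_L T_R θ z wp := by
  have h1 : ∫ _u in (0 : ℝ)..1, (1 : ℝ) = 1 := by simp
  calc (1 : ℝ) = ∫ _u in (0 : ℝ)..1, (1 : ℝ) := h1.symm
    _ ≤ energyBudget ω₂ lam β γ N T_L T_R θ z wp :=
        intervalIntegral.integral_mono_on zero_le_one intervalIntegrable_const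
          ((continuous_exp_mul_pathEnergy hω hl hβ hγ θ z wp).intervalIntegrable _ _)
          fun u _ => Real.one_le_exp (mul_nonneg hθ (pathEnergy_nonneg hω.le hl hβ z wp u))

end Budget

/-! ## 2. Power means increase (Jensen for `x ↦ x^r` on a unit window) -/

/-- **Power means increase**: for continuous `g ≥ 0` and `r ≥ 1`, `(∫₀¹ g)^r ≤ ∫₀¹ g^r`
(integrate the tangent-line inequality `m^r (1 + r (g/m - 1)) ≤ g^r` at the mean `m`, which is
Bernoulli's inequality). [folklore] -/
theorem rpow_intervalIntegral_le {g : ℝ → ℝ} (hg : Continuous g) (hg0 : ∀ u, 0 ≤ g u) {r : ℝ}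
    (hr : 1 ≤ r) : (∫ u in (0 : ℝ)..1, g u) ^ r ≤ ∫ u in (0 : ℝ)..1, g u ^ r := by
  set m := ∫ u in (0 : ℝ)..1, g u with hm
  have hr0 : 0 ≤ r := zero_le_one.trans hr
  have hm0 : 0 ≤ m := intervalIntegral.integral_nonneg zero_le_one fun u _ => hg0 u
  have hgr : Continuous fun u => g u ^ r := hg.rpow_const fun u => Or.inr hr0
  have hI0 : 0 ≤ ∫ u in (0 : ℝ)..1, g u ^ r :=
    intervalIntegral.integral_nonneg zero_le_one fun u _ => Real.rpow_nonneg (hg0 u) r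
  rcases hm0.eq_or_lt with hm0' | hmpos
  · rw [← hm0', Real.zero_rpow (by linarith)]
    exact hI0
  -- tangent line of `x ↦ x^r` at `m > 0`
  have htan : ∀ u, m ^ r * (1 + r * (g u / m - 1)) ≤ g u ^ r := by
    intro u
    have hs : -1 ≤ g u / m - 1 := by
      have : 0 ≤ g u / m := div_nonneg (hg0 u) hmpos.le
      linarith
    have hb := one_add_mul_self_le_rpow_one_add hs hr
    have h1 : 1 + (g u / m - 1) = g u / m := by ring
    rw [h1, Real.div_rpow (hg0 u) hmpos.le, le_div_iff₀ (Real.rpow_pos_of_pos hmpos r)] at hb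
    linarith
  have hlin : ∀ u, m ^ r * (1 + r * (g u / m - 1)) = m ^ r * (1 - r) + m ^ r * r / m * g u := by
    intro u
    ring
  have hint : ∫ u in (0 : ℝ)..1, m ^ r * (1 + r * (g u / m - 1)) = m ^ r := by
    simp_rw [hlin]
    have i1 : IntervalIntegrable (fun _ : ℝ => m ^ r * (1 - r)) volume 0 1 :=
      intervalIntegrable_const
    have i2 : IntervalIntegrable (fun u => m ^ r * r / m * g u) volume 0 1 :=
      (continuous_const.mul hg).intervalIntegrable _ _
    rw [intervalIntegral.integral_add i1 i2, intervalIntegral.integral_const,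
      intervalIntegral.integral_const_mul, ← hm, sub_zero, one_smul, div_mul_cancel₀ _ hmpos.ne']
    ring
  calc m ^ r = ∫ u in (0 : ℝ)..1, m ^ r * (1 + r * (g u / m - 1)) := hint.symm
    _ ≤ ∫ u in (0 : ℝ)..1, g u ^ r :=
        intervalIntegral.integral_mono_on zero_le_one
          ((continuous_const.mul (continuous_const.add (continuous_const.mul
            ((hg.div_const _).sub continuous_const)))).intervalIntegrable _ _)
          (hgr.intervalIntegrable _ _) fun u _ => htan u

/-! ## 3. (EBM): the exponential moment of the energy budget — PROVED -/

section Moment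

variable {ω₂ lam β γ : ℝ} (hω : 0 < ω₂) (hl : 0 ≤ lam) (hβ : 0 ≤ β) (hγ : 0 ≤ γ) {N : ℕ}
  (hN : 0 < N) {T_L T_R : ℝ} (hTL : 0 < T_L) (hTR : 0 < T_R)

include hω hl hβ hγ in
/-- Joint measurability of `(u, wp) ↦ exp(θ H(Φ_u(z, B(wp))))` (continuous in `u`, measurable in
`wp`). [folklore] -/
theorem measurable_uncurry_exp_pathEnergy (θ : ℝ) (z : PhaseSpace N) :
    Measurable (Function.uncurry fun (u : ℝ) (wp : WienerPair) =>
      ENNReal.ofReal (Real.exp (θ * pathEnergy ω₂ lam β γ N T_L T_R z wp u))) :=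
  measurable_uncurry_of_continuous_of_measurable
    (fun wp => ENNReal.continuous_ofReal.comp (continuous_exp_mul_pathEnergy hω hl hβ hγ θ z wp))
    fun u => ENNReal.measurable_ofReal.comp
      ((measurable_const.mul (measurable_pathEnergy hω hl hβ hγ z u)).exp)

include hω hl hβ hγ in
/-- The budget as a Lebesgue integral over `(0, 1]`. [folklore] -/
theorem ofReal_energyBudget_eq (θ : ℝ) (z : PhaseSpace N) (wp : WienerPair) :
    ENNReal.ofReal (energyBudget ω₂ lam β γ N T_L T_R θ z wp) =
      ∫⁻ u in Ioc 0 1, ENNReal.ofReal (Real.exp (θ * pathEnergy ω₂ lam β γ N T_L T_R z wp u)) := by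
  unfold energyBudget
  rw [intervalIntegral.integral_of_le zero_le_one]
  exact ofReal_integral_eq_lintegral_ofReal
    ((continuous_exp_mul_pathEnergy hω hl hβ hγ θ z wp).integrableOn_Icc.mono_set
      Ioc_subset_Icc_self) (ae_of_all _ fun u => (Real.exp_pos _).le)

include hω hl hβ hγ hN hTL hTR in
/-- **(EBM) along the flow — PROVED**: `E Θ_θ(z, ·) ≤ e^{θγ(T_L+T_R)} e^{θH(z)}` for
`0 < θ < 1/max(T_L, T_R)` (Tonelli + CEHR (3.4) at each fixed time `u ≤ 1`).
[cite: CuneoEckmannHairerReyBellet2018, §3 eq. (3.4)] -/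
theorem lintegral_energyBudget_le {θ : ℝ} (hθ : 0 < θ) (hθ' : θ < 1 / max T_L T_R)
    (z : PhaseSpace N) :
    ∫⁻ wp, ENNReal.ofReal (energyBudget ω₂ lam β γ N T_L T_R θ z wp) ∂wienerPair ≤
      ENNReal.ofReal (Real.exp (θ * γ * (T_L + T_R)) *
        Real.exp (θ * (pinnedChain ω₂ lam β γ).hamiltonian N z)) := by
  have hγT : 0 ≤ θ * γ * (T_L + T_R) := by positivity
  have hswap : ∫⁻ wp, (∫⁻ u in Ioc 0 1, ENNReal.ofReal
        (Real.exp (θ * pathEnergy ω₂ lam β γ N T_L T_R z wp u))) ∂wienerPair =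
      ∫⁻ u in Ioc 0 1, (∫⁻ wp, ENNReal.ofReal
        (Real.exp (θ * pathEnergy ω₂ lam β γ N T_L T_R z wp u)) ∂wienerPair) :=
    (lintegral_lintegral_swap (μ := volume.restrict (Ioc 0 1)) (ν := wienerPair)
      (measurable_uncurry_exp_pathEnergy hω hl hβ hγ θ z).aemeasurable).symm
  have hce : ∀ u ∈ Ioc (0 : ℝ) 1,
      ∫⁻ wp, ENNReal.ofReal (Real.exp (θ * pathEnergy ω₂ lam β γ N T_L T_R z wp u)) ∂wienerPair ≤
        ENNReal.ofReal (Real.exp (θ * γ * (T_L + T_R)) *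
          Real.exp (θ * (pinnedChain ω₂ lam β γ).hamiltonian N z)) := by
    intro u hu
    have h34 := pinnedChain_lintegral_exp_hamiltonian_solMap_le hω hl hβ hγ hN hTL hTR hθ hθ'
      u.toNNReal z
    rw [Real.coe_toNNReal u hu.1.le] at h34
    refine h34.trans (ENNReal.ofReal_le_ofReal
      (mul_le_mul_of_nonneg_right (Real.exp_le_exp.2 ?_) (Real.exp_pos _).le))
    exact mul_le_of_le_one_right hγT hu.2
  calc ∫⁻ wp, ENNReal.ofReal (energyBudget ω₂ lam β γ N T_L T_R θ z wp) ∂wienerPair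
      = ∫⁻ wp, (∫⁻ u in Ioc 0 1, ENNReal.ofReal
          (Real.exp (θ * pathEnergy ω₂ lam β γ N T_L T_R z wp u))) ∂wienerPair :=
        lintegral_congr fun wp => ofReal_energyBudget_eq hω hl hβ hγ θ z wp
    _ = ∫⁻ u in Ioc 0 1, (∫⁻ wp, ENNReal.ofReal
          (Real.exp (θ * pathEnergy ω₂ lam β γ N T_L T_R z wp u)) ∂wienerPair) := hswap
    _ ≤ ∫⁻ _u in Ioc 0 1, ENNReal.ofReal (Real.exp (θ * γ * (T_L + T_R)) *
          Real.exp (θ * (pinnedChain ω₂ lam β γ).hamiltonian N z)) :=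
        setLIntegral_mono measurable_const hce
    _ = ENNReal.ofReal (Real.exp (θ * γ * (T_L + T_R)) *
          Real.exp (θ * (pinnedChain ω₂ lam β γ).hamiltonian N z)) := by
        rw [setLIntegral_const, Real.volume_Ioc, sub_zero, ENNReal.ofReal_one, mul_one]

end Moment

/-! ## 4. The statement (EBM) -/

section StatementEBM

/-- The body of **(EBM)** at fixed chain parameters. [folklore] -/
def EnergyBudgetMomentBody (ω₂ lam β γ : ℝ) : Prop :=
  ∀ N : ℕ, 0 < N → ∀ T_L T_R θ : ℝ, 0 < T_L → 0 < T_R → 0 < θ → θ < 1 / max T_L T_R →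
    ∀ z : PhaseSpace N,
      ∫⁻ wp, ENNReal.ofReal (energyBudget ω₂ lam β γ N T_L T_R θ z wp) ∂wienerPair ≤
        ENNReal.ofReal (Real.exp (θ * γ * (T_L + T_R)) *
          Real.exp (θ * (pinnedChain ω₂ lam β γ).hamiltonian N z))

/-- **(EBM) `EnergyBudgetMoment`**: `E Θ_θ(z, ·) ≤ e^{θγ(T_L+T_R)} e^{θH(z)}` for
`0 < θ < 1/max(T_L, T_R)`, all `N ≥ 1`, `T_L, T_R > 0`, `ω₂ > 0`, `lam, β, γ ≥ 0`.
PROVED (`energyBudgetMoment`). [PROVED here · measure half beneath (MC∞)]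
(after CuneoEckmannHairerReyBellet2018, §3 eq. (3.4)) -/
def EnergyBudgetMoment : Prop :=
  ∀ ω₂ lam β γ : ℝ, 0 < ω₂ → 0 ≤ lam → 0 ≤ β → 0 ≤ γ → EnergyBudgetMomentBody ω₂ lam β γ

/-- **(EBM) — PROVED.** [cite: CuneoEckmannHairerReyBellet2018, §3 eq. (3.4)] -/
theorem energyBudgetMoment : EnergyBudgetMoment :=
  fun _ _ _ _ hω hl hβ hγ _ hN _ _ _ hTL hTR hθ hθ' z =>
    lintegral_energyBudget_le hω hl hβ hγ hN hTL hTR hθ hθ' z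

end StatementEBM

end Summit.AtomisticToContinuum.FouriersLaw.Theorems.ExtensiveSnapshotIrreversibility.EnergyWindow
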